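import Summits.CriticalPhenomena.PercolationContinuityZ3.Theorems.PercNearOneGluingNoHeavyLowerTailSahiTriangleClassT
import Mathlib.Tactic.Linarith
import Mathlib.Tactic.Ring
import Mathlib.Tactic.FieldSimp
import Mathlib.Tactic.LinearCombination
import HarnessLib

/-!
# `NoHeavyLowerTail` (crux stmt-CriticalPhenomena-4575), P2 — general triples `f(c,a), g(c,b), h(c,a,b)`: THE CAPPED-RATIO IDENTITY (part 1 of `…SahiSharedTwoPoint`)

Memo SAHI-ROUTE.md §4.28 (seat `prim-masterthm-p2`, gen 8; `--supports stmt-CriticalPhenomena-4575`).  No `sorry`, no named facts, standard axioms.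
Companion of `…SahiTriangleClassT` (there `h` ignores the block `γ` shared by `f` and `g`; here `h` is UNRESTRICTED but `γ` carries its weight on
two comparable points — for increasing events on a cube: `f` and `g` share at most ONE coordinate, `h` arbitrary).

SETTING.  `α, β` finite distributive lattices with FKG probability weights `wA, wB`; `γ` a finite preorder with a probability weight `wC` supported
on `{c₀, c₁}`, `c₀ ≤ c₁`; `f : γ → α → ℝ`, `g : γ → β → ℝ`, `h : γ → α → β → ℝ` nonnegative and coordinatewise monotone.  (Every triple of monotone
functions on a product of three blocks has this shape once `γ ⊇ supp f ∩ supp g`; nothing is assumed about `h`.)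

**THEOREM (`sahiE_three_nonneg_sharedTwoPoint`).  `E_3(f,g,h) ≥ 0`** under the product weight on `α × β × γ`.

PROOF (SAHI-ROUTE §4.28).  With `Y(c,b) = E_a[f(c,·)h(c,·,b)]`, `F(c) = E_a f(c,·)`, `H(c,b) = E_a h(c,·,b)`, `G(b) = E_c g(·,b)`, `Ȳ(c) = E_b Y(c,·)`,
`EH = E h`, `EF = E f`, the CAPPED RATIO `ρ(c) = min(1, EH·F(c)/Ȳ(c))` and its DEFECT `ψ(c) = EH·F(c) − ρ(c)Ȳ(c) = (EH·F(c) − Ȳ(c))⁺`, the EXACT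
IDENTITY (`sahiE_three_eq`, valid for ANY finite `γ` and any probability weight `wC`; it uses only `ρȲ + ψ = EH·F`):
  `E_3 = E_b[Φ + Δ] + E_c[ ρ(c)·Cov_b(g(c,·), Y(c,·)) + (1−ρ(c))·Cov_b(G, Y(c,·)) ]`,
  `Φ(b) = E_c[ g(·,b)((2−ρ)Y(·,b) − EF·H(·,b)) − G(b)(1−ρ)Y(·,b) ]`,  `Δ(b) = −Cov_{wC}(g(·,b), ψ)`.
The covariances are `≥ 0` (FKG on `β`).  On two points `c₀ ≤ c₁` with `w₀ = wC(c₀)`, `w₁ = 1 − w₀`:  `ψ(c₁) = 0` (FKG on `α` gives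
`Ȳ(c₁) ≥ F(c₁)H̄(c₁) ≥ F(c₁)·EH`), so `Δ(b) = w₀w₁(g(c₁,b) − g(c₀,b))ψ(c₀) ≥ 0`; and
`Φ(b) = w₁(g₁−g₀)·A₁ + g₀·S` with `A₁ = w₁(Y₁ − F₁H₁) + w₀[(2−ρ₁)Y₁ − F₀H₁ − (1−ρ₀)Y₀] ≥ 0` (FKG on `α` and the MARGIN
`(2−ρ(c₁))Y(c₁,b) ≥ F(c₀)H(c₁,b) + (1−ρ(c₀))Y(c₀,b)`, which follows from the ratio condition `(⋆) F(c₀) ≤ (1−ρ(c₁)+ρ(c₀))F(c₁)`) and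
`S = w₀(Y₀ − F₀H₀) + w₁(Y₁ − F₁H₁) + w₀w₁(F₁−F₀)(H₁−H₀) ≥ 0`.
-/

noncomputable section

open scoped Classical

namespace Summit.CriticalPhenomena.PercolationContinuityZ3.Theorems

namespace SahiSharedTwoPoint

open Finset
open Literature.Combinatorics.Sahi2008
open SahiChainTriangle (ex_prod3)
open SahiTriangleClassT (sum_factor swap_bc pull)

section Defs

variable {α β γ : Type} [Fintype α] [Fintype β] [Fintype γ]
  (wA : α → ℝ) (wB : β → ℝ) (wC : γ → ℝ) (f : γ → α → ℝ) (g : γ → β → ℝ) (h : γ → α → β → ℝ)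

/-- `Y(c,b) = E_a[f(c,a) h(c,a,b)]`. [this work] -/
def Y (c : γ) (b : β) : ℝ := ∑ a, wA a * (f c a * h c a b)
/-- `F(c) = E_a f(c,a)`. [this work] -/
def FC (c : γ) : ℝ := ∑ a, wA a * f c a
/-- `H(c,b) = E_a h(c,a,b)`. [this work] -/
def HH (c : γ) (b : β) : ℝ := ∑ a, wA a * h c a b
/-- `G(b) = E_c g(c,b)`. [this work] -/
def GG (b : β) : ℝ := ∑ c, wC c * g c b
/-- `G_C(c) = E_b g(c,b)`. [this work] -/
def GC (c : γ) : ℝ := ∑ b, wB b * g c b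
/-- `Ȳ(c) = E_b Y(c,b)`. [this work] -/
def Ybar (c : γ) : ℝ := ∑ b, wB b * Y wA f h c b
/-- `H̄(c) = E_b H(c,b)`. [this work] -/
def Hbar (c : γ) : ℝ := ∑ b, wB b * HH wA h c b
/-- `EH = E h`. [this work] -/
def EH : ℝ := ∑ c, wC c * Hbar wA wB h c
/-- `EF = E f`. [this work] -/
def EF : ℝ := ∑ c, wC c * FC wA f c
/-- `Ḡ = E g`. [this work] -/
def Gbar : ℝ := ∑ b, wB b * GG wC g b
/-- The CAPPED RATIO `ρ(c) = min(1, EH·F(c)/Ȳ(c))`. [this work] -/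
def rho (c : γ) : ℝ :=
  if Ybar wA wB f h c ≤ EH wA wB wC h * FC wA f c then 1 else EH wA wB wC h * FC wA f c / Ybar wA wB f h c
/-- The defect `ψ(c) = EH·F(c) − ρ(c)Ȳ(c)` (`= (EH·F(c) − Ȳ(c))⁺`). [this work] -/
def psi (c : γ) : ℝ := EH wA wB wC h * FC wA f c - rho wA wB wC f h c * Ybar wA wB f h c
/-- The pointwise kernel `Φ(b) = E_c[g(·,b)((2−ρ)Y(·,b) − EF·H(·,b)) − G(b)(1−ρ)Y(·,b)]`. [this work] -/
def Phi (b : β) : ℝ := ∑ c, wC c * (g c b * ((2 - rho wA wB wC f h c) * Y wA f h c b - EF wA wC f * HH wA h c b) -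
  GG wC g b * ((1 - rho wA wB wC f h c) * Y wA f h c b))
/-- The defect kernel `Δ(b) = −Cov_{wC}(g(·,b), ψ)`. [this work] -/
def Delta (b : β) : ℝ := GG wC g b * (∑ c, wC c * psi wA wB wC f h c) - ∑ c, wC c * (g c b * psi wA wB wC f h c)

end Defs

section Main

variable {α β γ : Type} [Fintype α] [Fintype β] [Fintype γ]
  {wA : α → ℝ} {wB : β → ℝ} {wC : γ → ℝ} {f : γ → α → ℝ} {g : γ → β → ℝ} {h : γ → α → β → ℝ}

/-! ### Plumbing -/

omit [Fintype α] [Fintype β] [Fintype γ] in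
/-- The bookkeeping identity behind `sahiE_three_eq` (finite sums of reals; `ps = Hb·q − r·vb` per point, `Fb` free). [this work] -/
theorem csum_identity (w SY SGY SGH q vb r gc ps : γ → ℝ) (Gb Hb Fb : ℝ) (hps : ∀ c, ps c = Hb * q c - r c * vb c)
    (s : Finset γ) :
    2 * (∑ c ∈ s, w c * SY c) + (∑ c ∈ s, w c * q c) * Gb * Hb -
        (Fb * (∑ c ∈ s, w c * SGH c) + Gb * (∑ c ∈ s, w c * vb c) + Hb * ∑ c ∈ s, w c * (q c * gc c)) =
      (∑ c ∈ s, w c * ((2 - r c) * SY c - Fb * SGH c - (1 - r c) * SGY c)) +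
        (Gb * (∑ c ∈ s, w c * ps c) - ∑ c ∈ s, w c * (gc c * ps c)) +
        ∑ c ∈ s, w c * (r c * (SY c - gc c * vb c) + (1 - r c) * (SGY c - Gb * vb c)) := by
  induction s using Finset.induction_on with
  | empty => simp
  | insert a s ha ih =>
    simp only [sum_insert ha]
    linear_combination ih + w a * (gc a - Gb) * hps a

/-- The seven moments of `(f,g,h)` in terms of `Y, F, H, G` (needs only `Σ wA = Σ wB = Σ wC = 1`). [this work] -/
theorem expectations (hA1 : ∑ a, wA a = 1) (hB1 : ∑ b, wB b = 1) :
    ex (fun q : α × β × γ => wA q.1 * wB q.2.1 * wC q.2.2)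
        ((fun q => f q.2.2 q.1) * (fun q => g q.2.2 q.2.1) * fun q => h q.2.2 q.1 q.2.1) =
      ∑ c, wC c * ∑ b, wB b * (g c b * Y wA f h c b) ∧
    ex (fun q : α × β × γ => wA q.1 * wB q.2.1 * wC q.2.2) ((fun q => f q.2.2 q.1) * fun q => g q.2.2 q.2.1) =
      ∑ c, wC c * (FC wA f c * GC wB g c) ∧
    ex (fun q : α × β × γ => wA q.1 * wB q.2.1 * wC q.2.2) ((fun q => f q.2.2 q.1) * fun q => h q.2.2 q.1 q.2.1) =
      ∑ c, wC c * Ybar wA wB f h c ∧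
    ex (fun q : α × β × γ => wA q.1 * wB q.2.1 * wC q.2.2) (fun q => f q.2.2 q.1) = EF wA wC f ∧
    ex (fun q : α × β × γ => wA q.1 * wB q.2.1 * wC q.2.2) ((fun q => g q.2.2 q.2.1) * fun q => h q.2.2 q.1 q.2.1) =
      ∑ c, wC c * ∑ b, wB b * (g c b * HH wA h c b) ∧
    ex (fun q : α × β × γ => wA q.1 * wB q.2.1 * wC q.2.2) (fun q => g q.2.2 q.2.1) = Gbar wB wC g ∧
    ex (fun q : α × β × γ => wA q.1 * wB q.2.1 * wC q.2.2) (fun q => h q.2.2 q.1 q.2.1) = EH wA wB wC h := by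
  refine ⟨?_, ?_, ?_, ?_, ?_, ?_, ?_⟩
  · have e : ((fun q : α × β × γ => f q.2.2 q.1) * (fun q => g q.2.2 q.2.1) * fun q => h q.2.2 q.1 q.2.1) =
        fun q => g q.2.2 q.2.1 * (f q.2.2 q.1 * h q.2.2 q.1 q.2.1) := by ext q; simp only [Pi.mul_apply]; ring
    rw [e, ex_prod3, sum_factor wA wB wC g (fun c a b => f c a * h c a b)]
    exact swap_bc wB wC (fun b c => g c b * Y wA f h c b)
  · have e : ((fun q : α × β × γ => f q.2.2 q.1) * fun q => g q.2.2 q.2.1) = fun q => g q.2.2 q.2.1 * f q.2.2 q.1 := by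
      ext q; simp only [Pi.mul_apply]; ring
    rw [e, ex_prod3, sum_factor wA wB wC g (fun c a _ => f c a), swap_bc wB wC (fun b c => g c b * ∑ a, wA a * f c a)]
    refine sum_congr rfl fun c _ => ?_
    unfold FC GC
    rw [pull wB (∑ a, wA a * f c a) (g c)]
  · have e : ((fun q : α × β × γ => f q.2.2 q.1) * fun q => h q.2.2 q.1 q.2.1) =
        fun q => (fun (_ : γ) (_ : β) => (1 : ℝ)) q.2.2 q.2.1 * (f q.2.2 q.1 * h q.2.2 q.1 q.2.1) := by
      ext q; simp only [Pi.mul_apply, one_mul]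
    rw [e, ex_prod3, sum_factor wA wB wC (fun _ _ => (1 : ℝ)) (fun c a b => f c a * h c a b)]
    simp only [one_mul]
    exact swap_bc wB wC (fun b c => ∑ a, wA a * (f c a * h c a b))
  · have e : (fun q : α × β × γ => f q.2.2 q.1) =
        fun q => (fun (_ : γ) (_ : β) => (1 : ℝ)) q.2.2 q.2.1 * ((fun c a (_ : β) => f c a) q.2.2 q.1 q.2.1) := by
      ext q; simp only [one_mul]
    rw [e, ex_prod3, sum_factor wA wB wC (fun _ _ => (1 : ℝ)) (fun c a _ => f c a)]
    unfold EF FC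
    simp only [one_mul]
    rw [← sum_mul, hB1, one_mul]
  · have e : ((fun q : α × β × γ => g q.2.2 q.2.1) * fun q => h q.2.2 q.1 q.2.1) =
        fun q => g q.2.2 q.2.1 * ((fun c a b => h c a b) q.2.2 q.1 q.2.1) := by ext q; simp only [Pi.mul_apply]
    rw [e, ex_prod3, sum_factor wA wB wC g (fun c a b => h c a b)]
    exact swap_bc wB wC (fun b c => g c b * HH wA h c b)
  · have e : (fun q : α × β × γ => g q.2.2 q.2.1) =
        fun q => g q.2.2 q.2.1 * ((fun (_ : γ) (_ : α) (_ : β) => (1 : ℝ)) q.2.2 q.1 q.2.1) := by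
      ext q; simp only [mul_one]
    rw [e, ex_prod3, sum_factor wA wB wC g (fun _ _ _ => (1 : ℝ))]
    unfold Gbar GG
    refine sum_congr rfl fun b _ => ?_
    simp only [mul_one, hA1]
  · have e : (fun q : α × β × γ => h q.2.2 q.1 q.2.1) =
        fun q => (fun (_ : γ) (_ : β) => (1 : ℝ)) q.2.2 q.2.1 * ((fun c a b => h c a b) q.2.2 q.1 q.2.1) := by
      ext q; simp only [one_mul]
    rw [e, ex_prod3, sum_factor wA wB wC (fun _ _ => (1 : ℝ)) (fun c a b => h c a b)]
    unfold EH Hbar HH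
    simp only [one_mul]
    exact swap_bc wB wC (fun b c => ∑ a, wA a * h c a b)

/-- The capped ratio: `0 ≤ ρ ≤ 1`, `ψ ≥ 0`, `ψ = 0 ∨ ρ = 1`, `Ȳ = 0 → ρ = 1`, `EH·F ≤ Ȳ → ψ = 0`, `EH·F − Ȳ ≤ ψ`. [this work] -/
theorem rho_spec (hA0 : ∀ a, 0 ≤ wA a) (hB0 : ∀ b, 0 ≤ wB b) (hC0 : ∀ c, 0 ≤ wC c) (hf0 : ∀ c a, 0 ≤ f c a)
    (hh0 : ∀ c a b, 0 ≤ h c a b) (c : γ) :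
    0 ≤ rho wA wB wC f h c ∧ rho wA wB wC f h c ≤ 1 ∧ 0 ≤ psi wA wB wC f h c ∧
      (psi wA wB wC f h c = 0 ∨ rho wA wB wC f h c = 1) ∧ (Ybar wA wB f h c = 0 → rho wA wB wC f h c = 1) ∧
      (EH wA wB wC h * FC wA f c ≤ Ybar wA wB f h c → psi wA wB wC f h c = 0) ∧
      EH wA wB wC h * FC wA f c - Ybar wA wB f h c ≤ psi wA wB wC f h c := by
  have hF : 0 ≤ FC wA f c := sum_nonneg fun a _ => mul_nonneg (hA0 a) (hf0 c a)
  have hE : 0 ≤ EH wA wB wC h := sum_nonneg fun d _ => mul_nonneg (hC0 d)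
    (sum_nonneg fun b _ => mul_nonneg (hB0 b) (sum_nonneg fun a _ => mul_nonneg (hA0 a) (hh0 d a b)))
  have hEF := mul_nonneg hE hF
  by_cases hle : Ybar wA wB f h c ≤ EH wA wB wC h * FC wA f c
  · have hρ : rho wA wB wC f h c = 1 := by simp [rho, hle]
    have hψ : psi wA wB wC f h c = EH wA wB wC h * FC wA f c - Ybar wA wB f h c := by rw [psi, hρ, one_mul]
    refine ⟨by rw [hρ]; norm_num, by rw [hρ], by rw [hψ]; linarith, Or.inr hρ, fun _ => hρ, fun hge => ?_, by rw [hψ]⟩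
    rw [hψ]; linarith
  · have hlt : EH wA wB wC h * FC wA f c < Ybar wA wB f h c := lt_of_not_ge hle
    have hYpos : 0 < Ybar wA wB f h c := lt_of_le_of_lt hEF hlt
    have hρ : rho wA wB wC f h c = EH wA wB wC h * FC wA f c / Ybar wA wB f h c := by simp [rho, hle]
    have hψ : psi wA wB wC f h c = 0 := by
      rw [psi, hρ, div_mul_cancel₀ _ hYpos.ne', sub_self]
    refine ⟨by rw [hρ]; exact div_nonneg hEF hYpos.le, by rw [hρ]; exact (div_le_one hYpos).mpr hlt.le, by rw [hψ],
      Or.inl hψ, fun h0 => absurd h0 hYpos.ne', fun _ => hψ, by rw [hψ]; linarith⟩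

omit [Fintype γ] in
/-- `ρ(c)Ȳ(c) + ψ(c) = EH·F(c)` (definition of `ψ`). [this work] -/
theorem rho_psi [Fintype γ] (c : γ) :
    rho wA wB wC f h c * Ybar wA wB f h c + psi wA wB wC f h c = EH wA wB wC h * FC wA f c := by
  unfold psi; ring

/-! ### The exact identity (any finite `γ`, any probability weight `wC`) -/

/-- `Σ_b wB (Φ(b) + Δ(b))` as `c`-sums of the point moments. [this work] -/
theorem sum_PhiDelta :
    (∑ b, wB b * (Phi wA wB wC f g h b + Delta wA wB wC f g h b)) =
      (∑ c, wC c * ((2 - rho wA wB wC f h c) * (∑ b, wB b * (g c b * Y wA f h c b)) -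
        EF wA wC f * (∑ b, wB b * (g c b * HH wA h c b)) - (1 - rho wA wB wC f h c) * ∑ b, wB b * (GG wC g b * Y wA f h c b))) +
      (Gbar wB wC g * (∑ c, wC c * psi wA wB wC f h c) - ∑ c, wC c * (GC wB g c * psi wA wB wC f h c)) := by
  have hΦ : (∑ b, wB b * Phi wA wB wC f g h b) =
      ∑ c, wC c * ((2 - rho wA wB wC f h c) * (∑ b, wB b * (g c b * Y wA f h c b)) -
        EF wA wC f * (∑ b, wB b * (g c b * HH wA h c b)) - (1 - rho wA wB wC f h c) * ∑ b, wB b * (GG wC g b * Y wA f h c b)) := by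
    unfold Phi
    rw [swap_bc wB wC]
    refine sum_congr rfl fun c _ => ?_
    congr 1
    simp only [mul_sub, sum_sub_distrib, mul_sum]
    congr 1
    · congr 1
      · exact sum_congr rfl fun b _ => by ring
      · exact sum_congr rfl fun b _ => by ring
    · exact sum_congr rfl fun b _ => by ring
  have hΔ : (∑ b, wB b * Delta wA wB wC f g h b) =
      Gbar wB wC g * (∑ c, wC c * psi wA wB wC f h c) - ∑ c, wC c * (GC wB g c * psi wA wB wC f h c) := by
    unfold Delta
    simp only [mul_sub, sum_sub_distrib]
    congr 1
    · unfold Gbar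
      rw [sum_mul]
      exact sum_congr rfl fun b _ => by ring
    · rw [swap_bc wB wC (fun b c => g c b * psi wA wB wC f h c)]
      refine sum_congr rfl fun c _ => ?_
      unfold GC
      rw [pull wB (psi wA wB wC f h c) (g c)]
      ring
  simp only [mul_add, sum_add_distrib, hΦ, hΔ]

/-- **THE EXACT IDENTITY** `E_3 = E_b[Φ + Δ] + E_c[ρ Cov_b(g(c,·),Y(c,·)) + (1−ρ) Cov_b(G,Y(c,·))]` — for ANY finite `γ` and any
probability weight `wC` (uses only `ρȲ + ψ = EH·F`). [this work] -/
theorem sahiE_three_eq (hA1 : ∑ a, wA a = 1) (hB1 : ∑ b, wB b = 1) :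
    sahiE (fun q : α × β × γ => wA q.1 * wB q.2.1 * wC q.2.2) 3
        ![fun q => f q.2.2 q.1, fun q => g q.2.2 q.2.1, fun q => h q.2.2 q.1 q.2.1] =
      (∑ b, wB b * (Phi wA wB wC f g h b + Delta wA wB wC f g h b)) +
      ∑ c, wC c * (rho wA wB wC f h c * ((∑ b, wB b * (g c b * Y wA f h c b)) - GC wB g c * Ybar wA wB f h c) +
        (1 - rho wA wB wC f h c) * ((∑ b, wB b * (GG wC g b * Y wA f h c b)) - Gbar wB wC g * Ybar wA wB f h c)) := by
  obtain ⟨eFGH, eFG, eFH, eF, eGH, eG, eH⟩ := expectations (wC := wC) (f := f) (g := g) (h := h) hA1 hB1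
  rw [sahiE_three, eFGH, eFG, eFH, eF, eGH, eG, eH, sum_PhiDelta]
  unfold EF
  exact csum_identity wC (fun c => ∑ b, wB b * (g c b * Y wA f h c b)) (fun c => ∑ b, wB b * (GG wC g b * Y wA f h c b))
    (fun c => ∑ b, wB b * (g c b * HH wA h c b)) (FC wA f) (Ybar wA wB f h) (rho wA wB wC f h) (GC wB g)
    (psi wA wB wC f h) (Gbar wB wC g) (EH wA wB wC h) (∑ c, wC c * FC wA f c) (fun c => by unfold psi; ring) univ

end Main

/-! ### The identity for an ARBITRARY ratio `r : γ → ℝ` (appended 2026-08-21, SAHI-ROUTE §4.29)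

For every function `r` on `γ` put `ψ_r = EH·F − rȲ`.  The same bookkeeping gives
`E_3 = E_b[Φ_r + Δ_r] + E_c[r Cov_b(g(c,·),Y(c,·)) + (1−r) Cov_b(G,Y(c,·))]` — the capped ratio `rho` is one choice; the transport
ratio and the hybrid certificates of §4.29 are others.  Positivity of the covariance part needs `0 ≤ r ≤ 1`; of `E_b Δ_r` it needs
`Cov_c(1_U, rȲ − EH·F) ≥ 0` for up-sets `U`; of `Φ_r` the ratio condition `(⋆)`. -/

section Ratio

variable {α β γ : Type} [Fintype α] [Fintype β] [Fintype γ]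
  (wA : α → ℝ) (wB : β → ℝ) (wC : γ → ℝ) (f : γ → α → ℝ) (g : γ → β → ℝ) (h : γ → α → β → ℝ) (r : γ → ℝ)

/-- The defect of a general ratio: `ψ_r(c) = EH·F(c) − r(c)Ȳ(c)`. [this work] -/
def psiOf (c : γ) : ℝ := EH wA wB wC h * FC wA f c - r c * Ybar wA wB f h c
/-- The pointwise kernel of a general ratio: `Φ_r(b) = E_c[g(·,b)((2−r)Y(·,b) − EF·H(·,b)) − G(b)(1−r)Y(·,b)]`. [this work] -/
def PhiOf (b : β) : ℝ := ∑ c, wC c * (g c b * ((2 - r c) * Y wA f h c b - EF wA wC f * HH wA h c b) -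
  GG wC g b * ((1 - r c) * Y wA f h c b))
/-- The defect kernel of a general ratio: `Δ_r(b) = −Cov_{wC}(g(·,b), ψ_r)`. [this work] -/
def DeltaOf (b : β) : ℝ := GG wC g b * (∑ c, wC c * psiOf wA wB wC f h r c) - ∑ c, wC c * (g c b * psiOf wA wB wC f h r c)

variable {wA wB wC f g h r}

/-- `Σ_b wB (Φ_r(b) + Δ_r(b))` as `c`-sums of the point moments. [this work] -/
theorem sum_PhiDeltaOf :
    (∑ b, wB b * (PhiOf wA wC f g h r b + DeltaOf wA wB wC f g h r b)) =
      (∑ c, wC c * ((2 - r c) * (∑ b, wB b * (g c b * Y wA f h c b)) -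
        EF wA wC f * (∑ b, wB b * (g c b * HH wA h c b)) - (1 - r c) * ∑ b, wB b * (GG wC g b * Y wA f h c b))) +
      (Gbar wB wC g * (∑ c, wC c * psiOf wA wB wC f h r c) - ∑ c, wC c * (GC wB g c * psiOf wA wB wC f h r c)) := by
  have hΦ : (∑ b, wB b * PhiOf wA wC f g h r b) =
      ∑ c, wC c * ((2 - r c) * (∑ b, wB b * (g c b * Y wA f h c b)) -
        EF wA wC f * (∑ b, wB b * (g c b * HH wA h c b)) - (1 - r c) * ∑ b, wB b * (GG wC g b * Y wA f h c b)) := by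
    unfold PhiOf
    rw [swap_bc wB wC]
    refine sum_congr rfl fun c _ => ?_
    congr 1
    simp only [mul_sub, sum_sub_distrib, mul_sum]
    congr 1
    · congr 1
      · exact sum_congr rfl fun b _ => by ring
      · exact sum_congr rfl fun b _ => by ring
    · exact sum_congr rfl fun b _ => by ring
  have hΔ : (∑ b, wB b * DeltaOf wA wB wC f g h r b) =
      Gbar wB wC g * (∑ c, wC c * psiOf wA wB wC f h r c) - ∑ c, wC c * (GC wB g c * psiOf wA wB wC f h r c) := by
    unfold DeltaOf
    simp only [mul_sub, sum_sub_distrib]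
    congr 1
    · unfold Gbar
      rw [sum_mul]
      exact sum_congr rfl fun b _ => by ring
    · rw [swap_bc wB wC (fun b c => g c b * psiOf wA wB wC f h r c)]
      refine sum_congr rfl fun c _ => ?_
      unfold GC
      rw [pull wB (psiOf wA wB wC f h r c) (g c)]
      ring
  simp only [mul_add, sum_add_distrib, hΦ, hΔ]

/-- **THE EXACT IDENTITY FOR AN ARBITRARY RATIO `r`**:
`E_3 = E_b[Φ_r + Δ_r] + E_c[r Cov_b(g(c,·),Y(c,·)) + (1−r) Cov_b(G,Y(c,·))]`, any finite `γ`, any probability weights. [this work] -/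
theorem sahiE_three_eq_of_ratio (r : γ → ℝ) (hA1 : ∑ a, wA a = 1) (hB1 : ∑ b, wB b = 1) :
    sahiE (fun q : α × β × γ => wA q.1 * wB q.2.1 * wC q.2.2) 3
        ![fun q => f q.2.2 q.1, fun q => g q.2.2 q.2.1, fun q => h q.2.2 q.1 q.2.1] =
      (∑ b, wB b * (PhiOf wA wC f g h r b + DeltaOf wA wB wC f g h r b)) +
      ∑ c, wC c * (r c * ((∑ b, wB b * (g c b * Y wA f h c b)) - GC wB g c * Ybar wA wB f h c) +
        (1 - r c) * ((∑ b, wB b * (GG wC g b * Y wA f h c b)) - Gbar wB wC g * Ybar wA wB f h c)) := by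
  obtain ⟨eFGH, eFG, eFH, eF, eGH, eG, eH⟩ := expectations (wC := wC) (f := f) (g := g) (h := h) hA1 hB1
  rw [sahiE_three, eFGH, eFG, eFH, eF, eGH, eG, eH, sum_PhiDeltaOf]
  unfold EF
  exact csum_identity wC (fun c => ∑ b, wB b * (g c b * Y wA f h c b)) (fun c => ∑ b, wB b * (GG wC g b * Y wA f h c b))
    (fun c => ∑ b, wB b * (g c b * HH wA h c b)) (FC wA f) (Ybar wA wB f h) r (GC wB g)
    (psiOf wA wB wC f h r) (Gbar wB wC g) (EH wA wB wC h) (∑ c, wC c * FC wA f c) (fun c => by unfold psiOf; ring) univ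

/-- **Positivity of the covariance part** for `0 ≤ r ≤ 1` (FKG on `β`). [this work] -/
theorem covpart_nonneg_of_ratio [DistribLattice α] [DistribLattice β] [Preorder γ]
    (hA : IsFKGMeasure wA) (hB : IsFKGMeasure wB) (hC0 : ∀ c, 0 ≤ wC c)
    (hf0 : ∀ c a, 0 ≤ f c a) (hg0 : ∀ c b, 0 ≤ g c b) (hgb : ∀ c, Monotone (g c))
    (hh0 : ∀ c a b, 0 ≤ h c a b) (hhb : ∀ c a, Monotone (h c a)) (hr0 : ∀ c, 0 ≤ r c) (hr1 : ∀ c, r c ≤ 1) :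
    0 ≤ ∑ c, wC c * (r c * ((∑ b, wB b * (g c b * Y wA f h c b)) - GC wB g c * Ybar wA wB f h c) +
        (1 - r c) * ((∑ b, wB b * (GG wC g b * Y wA f h c b)) - Gbar wB wC g * Ybar wA wB f h c)) := by
  have hA0 := hA.nonneg
  have hY0 : ∀ c b, 0 ≤ Y wA f h c b := fun c b =>
    sum_nonneg fun a _ => mul_nonneg (hA0 a) (mul_nonneg (hf0 c a) (hh0 c a b))
  have hYb : ∀ c, Monotone (Y wA f h c) := fun c b b' hbb =>
    sum_le_sum fun a _ => mul_le_mul_of_nonneg_left (mul_le_mul_of_nonneg_left (hhb c a hbb) (hf0 c a)) (hA0 a)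
  have hG0 : ∀ b, 0 ≤ GG wC g b := fun b => sum_nonneg fun c _ => mul_nonneg (hC0 c) (hg0 c b)
  have hGb : Monotone (GG wC g) := fun b b' hbb => sum_le_sum fun c _ => mul_le_mul_of_nonneg_left (hgb c hbb) (hC0 c)
  refine sum_nonneg fun c _ => mul_nonneg (hC0 c) (add_nonneg ?_ ?_)
  · exact mul_nonneg (hr0 c) (sub_nonneg.mpr (SahiTriangleSupermodular.fkg_sum hB (hg0 c) (hY0 c) (hgb c) (hYb c)))
  · exact mul_nonneg (sub_nonneg.mpr (hr1 c)) (sub_nonneg.mpr (SahiTriangleSupermodular.fkg_sum hB hG0 (hY0 c) hGb (hYb c)))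

end Ratio

end SahiSharedTwoPoint

end Summit.CriticalPhenomena.PercolationContinuityZ3.Theorems
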